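import Summits.ABC.StewartYu.ArchG3ScheduleD
import Summits.ABC.StewartYu.ArchG3PackClosedV
import HarnessLib

/-!
# Cell abc-stewartyu, rung A1.L (crux r2 `ArchCoreRat`), WP-L.A under R34: the generic-denominator k-step / half-step record packages
# `ArchKStepHypD` / `ArchKStepOddHypD` / `ArchHalfStepHypD` FROM ONE INEQUALITY at `S(θ)` — the VIRTUAL instances

`Summits/ABC/StewartYu/ArchG3PackClosedVD.lean` — sequel to lp-1's `ArchG3StepPacksD` / `ArchG3ScheduleD` (the D-generic packs with the
virtual-box predicate `V`) and to `ArchG3PackClosedV` / `ArchG3SatData` / `ArchG3PackClosed` (closed forms) (cell `abc-stewartyu`, HOME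
`run/shared/lean/pub/abc-stewartyu/`; plan RULINGS R34, «R34 IMPLEMENTATION», lp-1 17:44:32Z / 18:02:20Z; seat p5 g8).  Theorems on `ArchG3Setup`;
no definition, no named fact, no record.  For the level polynomials `Rᵢ = Δ(·; i.1, H) ∘ 2^{ex}·` on unknowns `U` (`i.1 ≤ L₀`), a saturation
datum `F : S.SatData` and a virtual box `Bv` (`V w := ∀ j, |ν(w)ⱼ| ≤ Bvⱼ`, `ν(w) = w ᵥ* F.U`):

* **`archKStepHypD_of_ineqV`** / **`archKStepOddHypD_of_ineqV`** — the k-step packages with `Γ := GammaC L`, `DΔ := DΔC (YC c e L) T′`,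
  `Wd/Wn := WC …`, `den₀ a x := ν(H)^a`, **`Dm x := F.Dmv Bv x`** (virtual, `SatData.exists_int_Dmv_mul_prod`), from ONE inequality per
  `(x₁, a, μ)` with right-hand side `1/(ν(H)^a · Dmv Bv x₁)`;
* **`archHalfStepHypD_of_ineqV`** — the half-step package (`R → R′ = Δ∘2^{ex+1}· → Δ∘2^{ex}·`, `ca a = 2ᵃ`) with **`Dh a s := ν(H)^a · F.Dhv Bv s`**
  (`SatData.exists_int_lcm_pow_mul_Dhv_mul`), **`Mt := MtV A H ex L₀ T′ N₁ (γb + w)`** (slab form, `abs_hasse_mul_qEhZ_le_MtV`),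
  `Wh := WC H (ex+1) L₀ T′ N₁`, from ONE inequality per odd `s` and `(a, μ)`.
The `N = 1` instances (`V := True`, `Dm := monDen`) are `ArchG3PackClosed` / `ArchG3PackClosedHalf`.

WHAT THIS IS NOT: the inequalities (record `ArchG3Rec`, p1); the `(Q, V)` family invariant (`ArchG3VirtualBox`, lp-1); no crux moves.

## References
* Yu. V. Nesterenko, LNM 1819 (2003) — §3.4 (3.41)–(3.44) p. 105–107, §4.2 (4.24)–(4.35), §4.3 (4.36)–(4.51). [Nesterenko2003]
* K. Yu, Acta Math. 211 (2013) — Lemma 5.2, §1.1 (the `p`-adic model; cell `PadicG3SatSupply`). [Yu2013]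
-/

noncomputable section

open Finset Polynomial
open scoped Matrix
open Literature.NumberTheory.Transcendental
open Literature.NumberTheory.Transcendental.CW77 (heightProd)
open Literature.NumberTheory.Transcendental.CW77.Setup (Tau tauNorm)
open Summit.ABC.StewartYu.ArchSupply (scaledFeldR WC)
open scoped Nat

namespace Summit.ABC.StewartYu

namespace ArchG3Setup

variable (S : ArchG3Setup) {K : Type*}

/-- **`ArchKStepHypD` at `S(θ)` from one inequality** (symmetric nodes): virtual monomial denominator `Dm x := F.Dmv Bv x` on the virtual box
`V w := ∀ j, |ν(w)ⱼ| ≤ Bvⱼ`; everything else as in `archKStepHypU_of_ineq`. [cite: Nesterenko2003, §4.2 (4.24)–(4.35) and §3.4 (3.43)–(3.44); shape only] -/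
theorem archKStepHypD_of_ineqV (F : S.SatData) {H : ℕ} (hH : 1 ≤ H) (ex L₀ : ℕ) (U : Finset (ℕ × K)) (hU : ∀ i ∈ U, i.1 ≤ L₀)
    (L : Fin S.n → ℕ) (P : ℤ) {w : ℝ} (hw : 0 ≤ w) (γb : ℝ) (c : ℤ) (e : Fin S.n → ℤ) {δ₀ : ℝ} (Bv : Fin S.n → ℕ)
    {N N' T T' t : ℕ} (ht : 1 ≤ t) (hT : T' + t ≤ T) (hN' : N' ≤ 3 * N + 2) {A : Fin S.n → ℝ} (hA : ∀ k, |S.lg k| ≤ A k)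
    {E : ℝ} (hE : 1 ≤ E) (hsmall : (L S.j₀ : ℝ) * δ₀ * (3 * N + 2) ≤ 1) {C : ℝ} (hC : 1 ≤ C)
    (hineq : ∀ x₁ : ℤ, |x₁| ≤ (N' : ℤ) → ∀ (a : ℕ) (μ : Fin S.n → ℕ), a + ∑ k, μ k < T' →
      Real.exp (γb * N') *
        (2 * ((2 * N + 1 : ℕ) : ℝ) ^ (t + 1) * t * (20 * Real.exp 1) ^ ((2 * N + 1) * t) *
            ((2 * C) ^ t * Real.exp (γb * (N + 1)) *
              ((2 : ℝ) ^ a * Real.exp ((∑ k, A k * S.GammaC L k) / C) *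
                (U.card * (P * DΔC (S.YC c e L) T') * WC H ex L₀ T (3 * N + 2) * Real.exp ((γb + w) * N) *
                  (2 * ((L S.j₀ : ℝ) * δ₀ * N))))) +
          U.card * (P * DΔC (S.YC c e L) T') * WC H ex L₀ T' ((3 * E + 1) * (2 * N + 1) + N) *
            Real.exp ((w + (L S.j₀ : ℝ) * δ₀) * ((3 * E + 1) * (2 * N + 1) + N)) * (1 / E) ^ ((2 * N + 1) * t)) +
        U.card * (P * DΔC (S.YC c e L) T') * WC H ex L₀ T (3 * N + 2) * Real.exp ((γb + w) * N') *
          (2 * ((L S.j₀ : ℝ) * δ₀ * N')) <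
      1 / (((Nat.lcmUpto H) ^ a * F.Dmv Bv x₁ : ℕ) : ℝ)) :
    S.ArchKStepHypD (fun i : ℕ × K => scaledFeldR i.1 H ex) U L P w γb c e δ₀ (fun w' => ∀ j, |(w' ᵥ* F.U) j| ≤ (Bv j : ℤ))
      N N' T T' := by
  have hE0 : (0 : ℝ) ≤ E := le_trans zero_le_one hE
  have hρn : (0 : ℝ) ≤ 3 * N + 2 := by positivity
  refine ⟨t, A, S.GammaC L, DΔC (S.YC c e L) T', E, WC H ex L₀ T' ((3 * E + 1) * (2 * N + 1) + N), WC H ex L₀ T (3 * N + 2), C,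
    fun a _ => (Nat.lcmUpto H) ^ a, fun x => F.Dmv Bv x, ht, hT, hN', hA, S.GammaC_nonneg L, fun w' hw' k => S.abs_zγ_le_GammaC hw' k,
    DΔC_nonneg (S.YC_nonneg c e L) T', fun w' hw' a μ haμ => S.abs_prod_multichoose_le_DΔC c e hw' haμ, hE, ?_,
    ArchSupply.WC_nonneg H ex L₀ T hρn, ?_, hw, hsmall, hC, fun a _ => Nat.one_le_pow _ _ (Nat.lcmUpto_pos H), ?_,
    fun x => F.one_le_Dmv Bv x, ?_, hineq⟩
  · intro i hi a ha z hz
    exact ArchSupply.norm_hw_le_WC hH ex i (hU i hi) ha.le hz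
  · intro i hi t₀ ht₀ x hx
    have hx' : |(x : ℝ)| ≤ 3 * N + 2 := by exact_mod_cast hx
    exact ArchSupply.abs_hasse_le_WC hH ex i (hU i hi) ht₀.le hx'
  · intro a _ x _ i _
    exact ArchSupply.exists_int_lcm_pow_mul_hasse_scaledFeldR_int i.1 hH ex a x
  · intro x _ w' _ hV
    exact F.exists_int_Dmv_mul_prod hV x

/-- **`ArchKStepOddHypD` at `S(θ)` from one inequality** (first k-step of a level, odd nodes): as `archKStepOddHypU_of_ineq` with the virtual
monomial denominator `Dm x := F.Dmv Bv x`. [cite: Nesterenko2003, §4.2 with the nodes 𝒳_{s,0}; shape only] -/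
theorem archKStepOddHypD_of_ineqV (F : S.SatData) {H : ℕ} (hH : 1 ≤ H) (ex L₀ : ℕ) (U : Finset (ℕ × K)) (hU : ∀ i ∈ U, i.1 ≤ L₀)
    (L : Fin S.n → ℕ) (P : ℤ) {w : ℝ} (hw : 0 ≤ w) (γb : ℝ) (c : ℤ) (e : Fin S.n → ℤ) {δ₀ : ℝ} (Bv : Fin S.n → ℕ)
    {m N' T T' t : ℕ} (hm : 1 ≤ m) (ht : 1 ≤ t) (hT : T' + t ≤ T) (hN' : N' ≤ 6 * m) {A : Fin S.n → ℝ} (hA : ∀ k, |S.lg k| ≤ A k)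
    {E : ℝ} (hE : 1 ≤ E) (hsmall : (L S.j₀ : ℝ) * δ₀ * (6 * m) ≤ 1) {C : ℝ} (hC : 1 ≤ C)
    (hineq : ∀ x₁ : ℤ, |x₁| ≤ (N' : ℤ) → ∀ (a : ℕ) (μ : Fin S.n → ℕ), a + ∑ k, μ k < T' →
      Real.exp (γb * N') *
        (2 * ((2 * m : ℕ) : ℝ) ^ (t + 1) * t * (20 * Real.exp 1) ^ ((2 * m) * t) *
            (2 ^ t * ((2 * C) ^ t * Real.exp (γb * (2 * m)) *
              ((2 : ℝ) ^ a * Real.exp ((∑ k, A k * S.GammaC L k) / C) *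
                (U.card * (P * DΔC (S.YC c e L) T') * WC H ex L₀ T (6 * m) *
                  Real.exp ((γb + w) * ((2 * m - 1 : ℕ) : ℝ)) *
                  (2 * ((L S.j₀ : ℝ) * δ₀ * ((2 * m - 1 : ℕ) : ℝ))))))) +
          U.card * (P * DΔC (S.YC c e L) T') * WC H ex L₀ T' ((12 * E + 6) * m) *
            Real.exp ((w + (L S.j₀ : ℝ) * δ₀) * ((12 * E + 6) * m)) * (1 / E) ^ ((2 * m) * t)) +
        U.card * (P * DΔC (S.YC c e L) T') * WC H ex L₀ T (6 * m) * Real.exp ((γb + w) * N') *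
          (2 * ((L S.j₀ : ℝ) * δ₀ * N')) <
      1 / (((Nat.lcmUpto H) ^ a * F.Dmv Bv x₁ : ℕ) : ℝ)) :
    S.ArchKStepOddHypD (fun i : ℕ × K => scaledFeldR i.1 H ex) U L P w γb c e δ₀ (fun w' => ∀ j, |(w' ᵥ* F.U) j| ≤ (Bv j : ℤ))
      m N' T T' := by
  have hE0 : (0 : ℝ) ≤ E := le_trans zero_le_one hE
  have hρn : (0 : ℝ) ≤ 6 * m := by positivity
  refine ⟨t, A, S.GammaC L, DΔC (S.YC c e L) T', E, WC H ex L₀ T' ((12 * E + 6) * m), WC H ex L₀ T (6 * m), C,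
    fun a _ => (Nat.lcmUpto H) ^ a, fun x => F.Dmv Bv x, hm, ht, hT, hN', hA, S.GammaC_nonneg L,
    fun w' hw' k => S.abs_zγ_le_GammaC hw' k, DΔC_nonneg (S.YC_nonneg c e L) T',
    fun w' hw' a μ haμ => S.abs_prod_multichoose_le_DΔC c e hw' haμ, hE, ?_, ArchSupply.WC_nonneg H ex L₀ T hρn, ?_, hw, hsmall, hC,
    fun a _ => Nat.one_le_pow _ _ (Nat.lcmUpto_pos H), ?_, fun x => F.one_le_Dmv Bv x, ?_, hineq⟩
  · intro i hi a ha z hz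
    exact ArchSupply.norm_hw_le_WC hH ex i (hU i hi) ha.le hz
  · intro i hi t₀ ht₀ x hx
    have hx' : |(x : ℝ)| ≤ 6 * m := by exact_mod_cast hx
    exact ArchSupply.abs_hasse_le_WC hH ex i (hU i hi) ht₀.le hx'
  · intro a _ x _ i _
    exact ArchSupply.exists_int_lcm_pow_mul_hasse_scaledFeldR_int i.1 hH ex a x
  · intro x _ w' _ hV
    exact F.exists_int_Dmv_mul_prod hV x

/-- **`ArchHalfStepHypD` at `S(θ)` from one inequality** (`R = Δ(·; i.1, H) ∘ 2^{ex+1}· → R′ = Δ(·; i.1, H) ∘ 2^{ex}·`, `ca a = 2ᵃ`): virtual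
termwise denominator `Dh a s := ν(H)^a · F.Dhv Bv s` on the virtual box, slab-form termwise size `Mt := MtV A H ex L₀ T′ N₁ (γb + w)` (F = 1),
`Wh := WC H (ex+1) L₀ T′ N₁`. [cite: Nesterenko2003, §4.3 (4.36)–(4.51); shape only] -/
theorem archHalfStepHypD_of_ineqV (F : S.SatData) {H : ℕ} (hH : 1 ≤ H) (ex L₀ : ℕ) (U : Finset (ℕ × K)) (hU : ∀ i ∈ U, i.1 ≤ L₀)
    (L : Fin S.n → ℕ) (P : ℤ) {w : ℝ} (hw : 0 ≤ w) (γb : ℝ) (c : ℤ) (e : Fin S.n → ℤ) {c' : ℤ} (hc' : c' ≠ 0) {δ₀ : ℝ}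
    (Bv : Fin S.n → ℕ) {N N₁ T T' t : ℕ} (ht : 1 ≤ t) (hT : T' + t ≤ T) (hN₁ : 2 * N₁ ≤ 6 * N + 5)
    {A : Fin S.n → ℝ} (hA : ∀ k, |S.lg k| ≤ A k) {E : ℝ} (hE : 1 ≤ E) (hsmall : (L S.j₀ : ℝ) * δ₀ * (3 * N + 2) ≤ 1)
    {C : ℝ} (hC : 1 ≤ C)
    (hineq : ∀ s : ℤ, Odd s → |s| ≤ 2 * (N₁ : ℤ) - 1 → ∀ (a : ℕ) (μ : Fin S.n → ℕ), a + ∑ k, μ k < T' →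
      Real.exp (γb * (3 * N + 2)) *
          (2 * ((2 * N + 1 : ℕ) : ℝ) ^ (t + 1) * t * (20 * Real.exp 1) ^ ((2 * N + 1) * t) *
              ((2 * C) ^ t * Real.exp (γb * (N + 1)) *
                ((2 : ℝ) ^ a * Real.exp ((∑ k, A k * S.GammaC L k) / C) *
                  (U.card * (P * DΔC (S.YC c e L) T') * WC H (ex + 1) L₀ T N * Real.exp ((γb + w) * N) *
                    (2 * ((L S.j₀ : ℝ) * δ₀ * N))))) +
            U.card * (P * DΔC (S.YC c e L) T') * WC H (ex + 1) L₀ T' ((3 * E + 1) * (2 * N + 1) + N) *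
              Real.exp ((w + (L S.j₀ : ℝ) * δ₀) * ((3 * E + 1) * (2 * N + 1) + N)) * (1 / E) ^ ((2 * N + 1) * t)) +
        U.card * (P * DΔC (S.YC c e L) T') * WC H (ex + 1) L₀ T' N₁ * Real.exp ((γb + w) * (3 * N + 2)) *
          (2 * ((L S.j₀ : ℝ) * δ₀ * (3 * N + 2))) <
      (1 + U.card * (P * DΔC (S.YC c e L) T') * S.MtV A H ex L₀ T' N₁ (γb + w)) /
        (4 * (((Nat.lcmUpto H) ^ a * F.Dhv Bv s : ℕ) : ℝ) * (1 + U.card * (P * DΔC (S.YC c e L) T') * S.MtV A H ex L₀ T' N₁ (γb + w)) *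
          heightProd S.α ^ 2) ^ (2 ^ S.n)) :
    S.ArchHalfStepHypD (fun i : ℕ × K => scaledFeldR i.1 H (ex + 1)) (fun i : ℕ × K => scaledFeldR i.1 H ex) U L P w γb c e c' δ₀
      (fun w' => ∀ j, |(w' ᵥ* F.U) j| ≤ (Bv j : ℤ)) N N₁ T T' := by
  have hE0 : (0 : ℝ) ≤ E := le_trans zero_le_one hE
  refine ⟨t, fun a => (2 : ℚ) ^ a, A, S.GammaC L, DΔC (S.YC c e L) T', E, WC H (ex + 1) L₀ T' ((3 * E + 1) * (2 * N + 1) + N),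
    WC H (ex + 1) L₀ T N, WC H (ex + 1) L₀ T' N₁, C, S.MtV A H ex L₀ T' N₁ (γb + w), fun a s => (Nat.lcmUpto H) ^ a * F.Dhv Bv s,
    ht, hT, hN₁, fun a => pow_ne_zero _ two_ne_zero, ?_, hc', hA, S.GammaC_nonneg L, fun w' hw' k => S.abs_zγ_le_GammaC hw' k,
    DΔC_nonneg (S.YC_nonneg c e L) T', fun w' hw' a μ haμ => S.abs_prod_multichoose_le_DΔC c e hw' haμ, hE, ?_,
    ArchSupply.WC_nonneg H (ex + 1) L₀ T (Nat.cast_nonneg N), ?_, ArchSupply.WC_nonneg H (ex + 1) L₀ T' (Nat.cast_nonneg N₁), ?_,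
    hw, hsmall, hC, fun a s => F.one_le_lcm_pow_mul_Dhv H a Bv s, ?_, S.MtV_nonneg A H ex L₀ T' N₁ (γb + w), ?_, hineq⟩
  · intro i _ a s
    exact ArchSupply.hasse_scaledFeldR_half i.1 H ex a (s : ℚ)
  · intro i hi a ha z hz
    exact ArchSupply.norm_hw_le_WC hH (ex + 1) i (hU i hi) ha.le hz
  · intro i hi t₀ ht₀ x hx
    have hx' : |(x : ℝ)| ≤ N := by exact_mod_cast hx
    exact ArchSupply.abs_hasse_le_WC hH (ex + 1) i (hU i hi) ht₀.le hx'
  · intro i hi a ha s _ hs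
    exact ArchSupply.norm_hw_le_WC hH (ex + 1) i (hU i hi) ha.le (norm_half_le_of_abs_le hs)
  · intro a _ s _ _ i _ w' _ hV _
    exact F.exists_int_lcm_pow_mul_Dhv_mul i.1 hH ex a hV s
  · intro a ha s _ hs i hi w' _ _ hL
    exact S.abs_hasse_mul_qEhZ_le_MtV hA hH ex i (hU i hi) ha hs hL

end ArchG3Setup

end Summit.ABC.StewartYu

end
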